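import Summits.KontsevichZagierPeriods.KontsevichZagierPeriods.Theorems.K2SymbolChainsJensenIsScissorsRotationAux

/-!
# Jensen is scissors — scalar facts for the radial step

Support file for item stmt-KontsevichZagierPeriods-5204 (`JensenIsScissors`, route
KontsevichZagierPeriods/K2SymbolChains). With `W_r(s) = ((1 − r)² + (1 + r)² s²)/(1 + s²)`
(`= |e^{iφ} − r|²`), the radial comparison of `W_ρ` and `W_{ρ²}` (`0 < ρ < 1`) runs along the
MONOTONE path `u = F(r) = ((1 − ρ²)/(1 − r))² · W_r(s)`, `r ∈ [ρ², ρ]`, from `F(ρ²) = W_{ρ²}(s)` to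
`F(ρ) = (1 + ρ)² W_ρ(s)`: `F(r) = (1 − ρ²)² (1 + c(r)² s²)/(1 + s²)` with `c(r) = (1 + r)/(1 − r)`
increasing, so `F` is strictly increasing for `s ≠ 0`. Its logarithmic derivative splits as
`∂ᵣ log F = 2/(1 − r) + ∂ᵣ log W_r`, and the key pointwise identity of the planner's chain is
`∂ᵣ log W_r(s) /(1 + s²) = (1/r) [1/(1 + s²) − c/(1 + c² s²)]`, whose two halves are identified by
the dilation `s ↦ c s`. We record these identities, the monotonicity / continuity / derivative of
`F` and of the auxiliary substitution `u = ((1 − ρ²)/(1 − r))²`. [folklore]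
-/

noncomputable section

open MeasureTheory Set
open Literature.NumberTheory.Transcendental Literature.ModelTheory.ExponentialFields

namespace Summit.KontsevichZagierPeriods.K2SymbolChains.JensenIsScissorsProof

open Literature.NumberTheory.Transcendental.KZ

/-! ### The path `F(r) = (1 − ρ²)² ((1 − r)² + (1 + r)² s²)/((1 − r)² (1 + s²))` -/

/-- `F(ρ²) = W_{ρ²}(s)`. [folklore] -/
theorem radF_left {ρ s : ℝ} (hρ1 : ρ ^ 2 ≠ 1) :
    (1 - ρ ^ 2) ^ 2 * ((1 - ρ ^ 2) ^ 2 + (1 + ρ ^ 2) ^ 2 * s ^ 2) / ((1 - ρ ^ 2) ^ 2 * (1 + s ^ 2)) =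
      ((1 - ρ ^ 2) ^ 2 + (1 + ρ ^ 2) ^ 2 * s ^ 2) / (1 + s ^ 2) := by
  have h1 : (1 - ρ ^ 2) ≠ 0 := sub_ne_zero.2 (Ne.symm hρ1)
  have h2 : (1 + s ^ 2) ≠ 0 := by positivity
  field_simp

/-- `F(ρ) = (1 + ρ)² W_ρ(s)`. [folklore] -/
theorem radF_right {ρ s : ℝ} (hρ1 : ρ ≠ 1) :
    (1 - ρ ^ 2) ^ 2 * ((1 - ρ) ^ 2 + (1 + ρ) ^ 2 * s ^ 2) / ((1 - ρ) ^ 2 * (1 + s ^ 2)) =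
      (1 + ρ) ^ 2 * (((1 - ρ) ^ 2 + (1 + ρ) ^ 2 * s ^ 2) / (1 + s ^ 2)) := by
  have h1 : (1 - ρ) ≠ 0 := sub_ne_zero.2 (Ne.symm hρ1)
  have h2 : (1 + s ^ 2) ≠ 0 := by positivity
  field_simp
  ring

/-- `F(r) = (1 − ρ²)² (1 + c² s²)/(1 + s²)`, `c = (1 + r)/(1 − r)`. [folklore] -/
theorem radF_eq {ρ s r : ℝ} (hr : r ≠ 1) :
    (1 - ρ ^ 2) ^ 2 * ((1 - r) ^ 2 + (1 + r) ^ 2 * s ^ 2) / ((1 - r) ^ 2 * (1 + s ^ 2)) =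
      (1 - ρ ^ 2) ^ 2 * (1 + ((1 + r) / (1 - r)) ^ 2 * s ^ 2) / (1 + s ^ 2) := by
  have h1 : (1 - r) ≠ 0 := sub_ne_zero.2 (Ne.symm hr)
  have h2 : (1 + s ^ 2) ≠ 0 := by positivity
  field_simp

/-- `F` is strictly increasing on `[ρ², ρ]` when `0 < ρ < 1` and `s ≠ 0`. [folklore] -/
theorem radF_strictMonoOn {ρ s : ℝ} (hρ0 : 0 < ρ) (hρ1 : ρ < 1) (hs : s ≠ 0) :
    StrictMonoOn (fun r : ℝ => (1 - ρ ^ 2) ^ 2 * ((1 - r) ^ 2 + (1 + r) ^ 2 * s ^ 2) /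
      ((1 - r) ^ 2 * (1 + s ^ 2))) (Icc (ρ ^ 2) ρ) := by
  intro a ha b hb hab
  have ha1 : a < 1 := ha.2.trans_lt hρ1
  have hb1 : b < 1 := hb.2.trans_lt hρ1
  have ha0 : 0 < a := (by positivity : (0:ℝ) < ρ ^ 2).trans_le ha.1
  simp only
  rw [radF_eq ha1.ne, radF_eq hb1.ne]
  have hρ2 : ρ ^ 2 < 1 := by nlinarith
  have hK : 0 < (1 - ρ ^ 2) ^ 2 := by
    have : 0 < 1 - ρ ^ 2 := by linarith
    positivity
  have hs2 : 0 < s ^ 2 := by positivity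
  have hca : 0 < (1 + a) / (1 - a) := div_pos (by linarith) (by linarith)
  have hcab : (1 + a) / (1 - a) < (1 + b) / (1 - b) := by
    rw [div_lt_div_iff₀ (by linarith) (by linarith)]
    nlinarith
  have hsq : ((1 + a) / (1 - a)) ^ 2 < ((1 + b) / (1 - b)) ^ 2 := by
    exact pow_lt_pow_left₀ hcab hca.le two_ne_zero
  have h2 : (1 + s ^ 2) ≠ 0 := by positivity
  rw [div_lt_div_iff_of_pos_right (by positivity)]
  nlinarith [mul_pos hK hs2]

/-- `F` is continuous on `[ρ², ρ]` (`ρ < 1`). [folklore] -/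
theorem radF_continuousOn {ρ s : ℝ} (hρ1 : ρ < 1) :
    ContinuousOn (fun r : ℝ => (1 - ρ ^ 2) ^ 2 * ((1 - r) ^ 2 + (1 + r) ^ 2 * s ^ 2) /
      ((1 - r) ^ 2 * (1 + s ^ 2))) (Icc (ρ ^ 2) ρ) := by
  refine ContinuousOn.div (by fun_prop) (by fun_prop) fun r hr => ?_
  have : (1 - r) ≠ 0 := by have := hr.2; linarith
  positivity

/-- The derivative of `F` in `r`. [folklore] -/
theorem hasDerivAt_radF (ρ s : ℝ) {r : ℝ} (hr : r ≠ 1) :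
    HasDerivAt (fun r : ℝ => (1 - ρ ^ 2) ^ 2 * ((1 - r) ^ 2 + (1 + r) ^ 2 * s ^ 2) /
      ((1 - r) ^ 2 * (1 + s ^ 2)))
      ((1 - ρ ^ 2) ^ 2 / (1 + s ^ 2) * (((2 * (1 + s ^ 2) * r + 2 * (s ^ 2 - 1)) * (1 - r) ^ 2 -
        ((1 + s ^ 2) * r ^ 2 + 2 * (s ^ 2 - 1) * r + (1 + s ^ 2)) * (2 * r - 2)) / ((1 - r) ^ 2) ^ 2)) r := by
  have h1 : (1 - r) ≠ 0 := sub_ne_zero.2 (Ne.symm hr)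
  have h2 : (1 + s ^ 2) ≠ 0 := by positivity
  have hq : ∀ t : ℝ, 1 * t ^ 2 + (-2) * t + 1 = (1 - t) ^ 2 := fun t => by ring
  have hQ : (1 : ℝ) * r ^ 2 + (-2) * r + 1 ≠ 0 := by rw [hq]; positivity
  have h := hasDerivAt_quad_div (c₀ := 1 + s ^ 2) (c₁ := 2 * (s ^ 2 - 1)) (c₂ := 1 + s ^ 2)
    (d₀ := 1) (d₁ := -2) (d₂ := 1) (t := r) hQ
  have h' := h.const_mul ((1 - ρ ^ 2) ^ 2 / (1 + s ^ 2))
  have hfun : (fun r : ℝ => (1 - ρ ^ 2) ^ 2 * ((1 - r) ^ 2 + (1 + r) ^ 2 * s ^ 2) /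
      ((1 - r) ^ 2 * (1 + s ^ 2))) = fun r => (1 - ρ ^ 2) ^ 2 / (1 + s ^ 2) *
      (((1 + s ^ 2) * r ^ 2 + 2 * (s ^ 2 - 1) * r + (1 + s ^ 2)) / (1 * r ^ 2 + (-2) * r + 1)) := by
    funext t
    by_cases ht : t = 1
    · subst ht; norm_num
    · have ht' : (1 - t) ≠ 0 := sub_ne_zero.2 (Ne.symm ht)
      rw [hq t]
      field_simp
      ring
  rw [hfun]
  refine h'.congr_deriv ?_
  simp only [hq]
  congr 1
  ring

/-- **The logarithmic derivative of `F`**: `F'/F = 2/(1 − r) + ∂ᵣ log W_r`, written against the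
weight: `(c₀/(1 + s²))/F · F' = c₀ · [2/((1 − r)(1 + s²)) + (1/r)(1/(1 + s²) − c/(1 + c² s²))]`,
`c = (1 + r)/(1 − r)`. [folklore] -/
theorem radF_logDeriv (c₀ ρ s : ℝ) {r : ℝ} (hr0 : r ≠ 0) (hr : r ≠ 1) (hρ1 : ρ ^ 2 ≠ 1)
    (hW : (1 - r) ^ 2 + (1 + r) ^ 2 * s ^ 2 ≠ 0) :
    c₀ / (1 + s ^ 2) / ((1 - ρ ^ 2) ^ 2 * ((1 - r) ^ 2 + (1 + r) ^ 2 * s ^ 2) / ((1 - r) ^ 2 * (1 + s ^ 2))) *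
        ((1 - ρ ^ 2) ^ 2 / (1 + s ^ 2) * (((2 * (1 + s ^ 2) * r + 2 * (s ^ 2 - 1)) * (1 - r) ^ 2 -
          ((1 + s ^ 2) * r ^ 2 + 2 * (s ^ 2 - 1) * r + (1 + s ^ 2)) * (2 * r - 2)) / ((1 - r) ^ 2) ^ 2)) =
      c₀ * (2 / (1 - r) / (1 + s ^ 2)) + c₀ / (1 + s ^ 2) / r -
        c₀ * ((1 + r) / (1 - r)) / ((1 + ((1 + r) / (1 - r)) ^ 2 * s ^ 2) * r) := by
  have h1 : (1 - r) ≠ 0 := sub_ne_zero.2 (Ne.symm hr)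
  have h2 : (1 + s ^ 2) ≠ 0 := by positivity
  have h3 : (1 - ρ ^ 2) ≠ 0 := sub_ne_zero.2 (Ne.symm hρ1)
  have h5 : (1 - r) ^ 2 + (1 + r) ^ 2 * s ^ 2 ≠ 0 := hW
  set Wn := (1 - r) ^ 2 + (1 + r) ^ 2 * s ^ 2 with hWn
  have hden : (1 + ((1 + r) / (1 - r)) ^ 2 * s ^ 2) = Wn / (1 - r) ^ 2 := by
    rw [hWn]; field_simp
  rw [hden]
  field_simp
  rw [hWn]
  ring

/-- `W_r(s) > 0` for `s ≠ 0`. [folklore] -/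
theorem W_num_pos_of_ne {r s : ℝ} (hs : s ≠ 0) (hr : -1 < r) : 0 < (1 - r) ^ 2 + (1 + r) ^ 2 * s ^ 2 := by
  have h1 : 0 < 1 + r := by linarith
  have : 0 < (1 + r) ^ 2 * s ^ 2 := by positivity
  positivity

/-! ### The substitution `u = ((1 − ρ²)/(1 − r))²` -/

/-- Endpoints of `u = ((1 − ρ²)/(1 − r))²`: `1` at `r = ρ²`, `(1 + ρ)²` at `r = ρ`. [folklore] -/
theorem radM_endpoints {ρ : ℝ} (hρ0 : 0 ≤ ρ) (hρ1 : ρ < 1) :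
    ((1 - ρ ^ 2) / (1 - ρ ^ 2)) ^ 2 = 1 ∧ ((1 - ρ ^ 2) / (1 - ρ)) ^ 2 = (1 + ρ) ^ 2 := by
  have h1 : (1 - ρ) ≠ 0 := by linarith
  have h2 : (1 - ρ ^ 2) ≠ 0 := by nlinarith
  refine ⟨by rw [div_self h2, one_pow], ?_⟩
  rw [show (1 - ρ ^ 2) / (1 - ρ) = 1 + ρ by field_simp; ring]

/-- `u = ((1 − ρ²)/(1 − r))²` is strictly increasing on `[ρ², ρ]` (`0 < ρ < 1`). [folklore] -/
theorem radM_strictMonoOn {ρ : ℝ} (hρ0 : 0 < ρ) (hρ1 : ρ < 1) :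
    StrictMonoOn (fun r : ℝ => ((1 - ρ ^ 2) / (1 - r)) ^ 2) (Icc (ρ ^ 2) ρ) := by
  intro a ha b hb hab
  have ha1 : a < 1 := ha.2.trans_lt hρ1
  have hb1 : b < 1 := hb.2.trans_lt hρ1
  have hK : 0 < 1 - ρ ^ 2 := by nlinarith
  have h1 : 0 < (1 - ρ ^ 2) / (1 - a) := div_pos hK (by linarith)
  have h2 : (1 - ρ ^ 2) / (1 - a) < (1 - ρ ^ 2) / (1 - b) :=
    div_lt_div_of_pos_left hK (by linarith) (by linarith)
  simp only
  exact pow_lt_pow_left₀ h2 h1.le two_ne_zero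

/-- Continuity of `u = ((1 − ρ²)/(1 − r))²` on `[ρ², ρ]`. [folklore] -/
theorem radM_continuousOn {ρ : ℝ} (hρ1 : ρ < 1) :
    ContinuousOn (fun r : ℝ => ((1 - ρ ^ 2) / (1 - r)) ^ 2) (Icc (ρ ^ 2) ρ) := by
  refine ContinuousOn.pow (ContinuousOn.div continuousOn_const (by fun_prop) fun r hr => ?_) 2
  have := hr.2; exact by linarith

/-- The derivative of `u = ((1 − ρ²)/(1 − r))²` is `2u/(1 − r)`, written against the weight:
`(c₀/u) · u' = 2 c₀/(1 − r)`. [folklore] -/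
theorem hasDerivAt_radM (ρ : ℝ) {r : ℝ} (hr : r ≠ 1) :
    HasDerivAt (fun r : ℝ => ((1 - ρ ^ 2) / (1 - r)) ^ 2)
      (2 * ((1 - ρ ^ 2) / (1 - r)) * ((1 - ρ ^ 2) / (1 - r) ^ 2)) r := by
  have h1 : (1 - r) ≠ 0 := sub_ne_zero.2 (Ne.symm hr)
  have hd : HasDerivAt (fun r : ℝ => (1 - ρ ^ 2) / (1 - r)) ((1 - ρ ^ 2) / (1 - r) ^ 2) r := by
    have hc : HasDerivAt (fun r : ℝ => 1 - r) (-1) r := by simpa using (hasDerivAt_id r).const_sub 1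
    have hi := hc.inv h1
    have h' := hi.const_mul (1 - ρ ^ 2)
    simp only [div_eq_mul_inv]
    refine h'.congr_deriv ?_
    field_simp
  have h2 := hd.mul hd
  have hfun : (fun r : ℝ => ((1 - ρ ^ 2) / (1 - r)) ^ 2) =
      fun r => ((1 - ρ ^ 2) / (1 - r)) * ((1 - ρ ^ 2) / (1 - r)) := by
    funext; ring
  rw [hfun]
  exact h2.congr_deriv (by ring)

/-- `(c₀/u) · u' = 2c₀/(1 − r)` for `u = ((1 − ρ²)/(1 − r))²`. [folklore] -/
theorem radM_weight (c₀ ρ : ℝ) {r : ℝ} (hr : r ≠ 1) (hρ1 : ρ ^ 2 ≠ 1) :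
    c₀ / ((1 - ρ ^ 2) / (1 - r)) ^ 2 * (2 * ((1 - ρ ^ 2) / (1 - r)) * ((1 - ρ ^ 2) / (1 - r) ^ 2)) =
      c₀ * (2 / (1 - r)) := by
  have h1 : (1 - r) ≠ 0 := sub_ne_zero.2 (Ne.symm hr)
  have h3 : (1 - ρ ^ 2) ≠ 0 := sub_ne_zero.2 (Ne.symm hρ1)
  field_simp

end Summit.KontsevichZagierPeriods.K2SymbolChains.JensenIsScissorsProof
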